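import Summits.QuantumFields.YangMills.Theorems.PencilRigidityDiagonalMirrorRPRReduction

/-!
# Line `kms-variance-lukewarm-descent` — crux `DiagonalMirrorRPR` (stmt-QuantumFields-10604) — skeleton (crux-plan, round 2)

Crux (shared verbatim by `Theses/PencilRigidity.lean` #5 and `Theses/MirrorModularBoosts.lean` #4): for every compact
simple `G`, `r`, `sch`, one-species family `S₁` with the curvature package `W₁ r sch S₁` (`CurvaturePackage`), `S₁` is
reflection positive in pull-back form in the four diagonal frames (`DiagonalFrameRP`).

**The line (merged lever of the round-2 cards `kms-variance-lukewarm-descent` ≈ `thermal-variance-transfer`; both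
triagers: same lever).**  Upstairs and closure are the LANDED halves of `parity-bridge-cold-traces` (S1 exact swap-RP
of Wilson's measure on the FILS 45° cover `T̃_N`, `β ≥ 0`; S4' OS-limit closure from cover insensitivity on
off-diagonal compact real families), composed in `Reduction.stub_reduction_coverTransport` (p96361).  What is new is
the TRANSPORT `T_N → T''_N → T̃_N` (statement's odd torus → its `e₁`-doubled torus → the 45° cover) by SECOND
MOMENTS of positive transfer matrices instead of coldness:

* thermal variance ≤ mirror covariance (termwise positivity of two-point traces for `𝕋 ≥ 0`, Wilson action, `β ≥ 0`):
  `Var_p(X̂) ≤ ⟨X · θ_{μ,d} X̄⟩ − |⟨X⟩|²` at ANY mirror distance `d` (KMS freedom), whose `k → ∞` limit is, by `hconv`,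
  the continuum mirror covariance `mirrorCov S₁ f μ d`, and `→ 0` as `d → ∞` (`MirrorClustering`);
* doubling `|⟨X⟩_{T''} − ⟨X⟩_{T}| ≤ √(Var_p / purity)`, twist `|⟨X⟩_{T̃} − ⟨X⟩_{T''}| ≤ √Var_q / twistWeight`
  (Cauchy–Schwarz), so the only thermodynamic input is LUKEWARMNESS — two `O(1)` floors on partition-function ratios of
  the scheme's own box tori (`SchemeLukewarm`, typed over the landed `tZ`), not ground-state dominance.

No sup norm of a renormalised string, no `c_k`, no rate, and `HasLatticeMassGap` is not consumed.

**Registered stubs** (5): `stub_mirrorClustering` (W₁-side clustering of the LIMIT for all off-diagonal compact real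
families along `e₀`, `e₁`: provable today for axis-orderable families from E4/`HasMassGap` + E3 + the proper signed
permutation `(e₀,e₁) ↦ (e₁,−e₀)`; for families with overlapping axis projections it is the named extra input (R0') —
conjecture-class, owed upstream), `stub_schemeLukewarm` (HARDEST: purity and twist-weight floors along the scheme —
finite-size free-energy control of Wilson's theory at physical scale; extra-`W₁`, conjecture-class, owed by the
existence leg), `stub_doublingStep` and `stub_twistStep` (the lever: slice transfer matrices `𝕋₁`, `𝔹 ≥ 0`
(Lüscher 1977 / Osterwalder–Seiler 1978), trace formulas `Z_T = Tr 𝕋₁ᴺ`, `Z_{T''} = Tr 𝕋₁²ᴺ = Tr 𝔹ᴺ`,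
`Z_{T̃} = Tr 𝔹ᴺ U_{Ne₁}`, the two inequalities above, `hconv`; expected TRUE, L each),
`stub_frequentlyNegativeCoupling` (scope: the crux on schemes with `β_k < 0` frequently — no lever; vacuous once the
planners add `∀ᶠ k, 0 ≤ sch.β k` to `W₁`, as every seat on this crux recommends).

**Composition** (`DiagonalMirrorRPR_of`, kernel-checked, no `sorry`): doubling + twist give the transport
`CurvaturePackage → (∀ᶠ k, 0 ≤ β_k) → CoverInsensitivityOffDiag` from the two W₁-side stubs; the landed reduction
closes the crux from transport + scope.

**Disproof items honoured** (`Cruxes/DiagonalMirrorRPR/Disproof.lean`, cycle 3): `Negative/HconvLoadBearing`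
(`Phantom.cruxWithoutLatticeConvergence_false`) — `hconv` is used in `stub_doublingStep`, `stub_twistStep` (three
tensors per family, all degrees, incl. `𝒩`-type supports) and is NECESSARY for `stub_mirrorClustering` (the phantom
family `vacuum + T₃` carries `W₁ ∖ hconv` and violates `MirrorClustering` at `n = 3`: covariance `≡ −T₃(f)² ≠ 0`);
`Negative/SquareTorusNotSwapRP` — no swap-RP of any square torus is asserted (the defect is transported, not denied);
`Negative/L1GaussianNotDiagonalRP` (§9, action specificity) — diagonal RP enters only through the Schur cut inside the
landed S1, and the transport uses `𝕋 ≥ 0` of Wilson's single-plaquette action (`β ≥ 0`), never axis data alone;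
§5(a) `twoSpin_pairing_neg_of_neg` + `Negative/OddTorusTwist` — `β ≥ 0` eventually is explicit in stubs 2–4, negative
couplings isolated in the scope stub; §7(b) BKM window — both comparison partners are boundaryless at the same `β_k`;
§2–§3 non-vacuity — at `β ≡ 0`: `tZ ≡ 1`, purity = twistWeight = 1, Var = 0, all stubs exact.
`ledger negatives`: only the settled misstated `DiagonalMirrorRP` (`S₁ 0` free) — untouched (E0 ∈ W₁; no variance reads degree 0).

## Lead reshape (lead a2, 2026-08-16): ONE tree over the two registered round-2 skeletons (7 stubs)

As the line card's plug-compatibility paragraph asks of a lead holding both `Lines/kms_variance_lukewarm_descent.lean`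
and `Lines/centre_twisted_swap.lean`: the registered stubs of this tree are

* kms stub 1 `stub_mirrorClustering` (verbatim) and kms stub 2 `stub_schemeLukewarm`, WIDENED in reshape cycle 1
  (2026-08-16T15:45Z) to `stub_schemeInputs : … → SchemeLukewarm ∧ ReflectedConvergence` (both conjecture-class): the
  lever's variance term is a string of the axis-REFLECTED curvature composite, which `W₁` does not control (§1
  `ReflectedConvergence`, crux `NOTES.md`); `DoublingStep`/`TwistStep` take `ReflectedConvergence r sch S₁` as input;
* kms stubs 3 ∧ 4 MERGED into the single lead-held lever stub `stub_secondMomentLever : DoublingStep ∧ TwistStep`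
  (`DoublingStep`, `TwistStep` verbatim; the two steps share all of their transfer-operator infrastructure — slicing
  of the box tori, `𝕋 ≥ 0`, trace formulas, slab insertions — so one owner proves both);
* kms stub 5 (`stub_frequentlyNegativeCoupling`: ALL data with `β_k < 0` frequently, no lever) REPLACED by the
  strictly finer cut of the sibling skeleton `centre_twisted_swap` (namespace `CentreTwistedSwap`, its vocabulary
  `centreTwist`/`twistSwapConfig`/`CoverTwistedSwapRPAt` verbatim): S1' `stub_twistedSwapRP` (M, provable), S4''
  `stub_rpClosureTwisted` (M, provable), T_c NARROWED to where the composition needs it,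
  `stub_coverTransportCentreNeg` (centre data AND `β_k < 0` frequently ⇒ cover insensitivity; conjecture-class —
  for `β_k ≥ 0` eventually the kms transport already serves centre data), N' `stub_centreBlindNegativeScope`
  (verbatim; scope, no lever).

Composition (`DiagonalMirrorRPR_of`, sorry-free): `β_k ≥ 0` eventually (any data) → kms transport
(`coverTransport_of` from stubs 1, 2 and the lever) + the landed `Reduction.diagonalFrameRP_of_coverInsensitivityOffDiag`;
`β_k < 0` frequently and centre data → `stub_coverTransportCentreNeg` + S1/S1' per `k` + S4''; `β_k < 0` frequently
and centre-blind data → N'.  Workers: stub 1 (orderable case), S1', S4''.  Lead: the lever.  Stub 2, T_c-neg, N' are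
not prover tasks (named residuals for the planners, as in every hand-back on this crux).
-/

set_option autoImplicit false

noncomputable section

open scoped SchwartzMap ComplexConjugate
open MeasureTheory Filter Topology
open Literature.MathematicalPhysics.QuantumLattice Literature.MathematicalPhysics.AQFT
  Literature.MathematicalPhysics.QuantumFieldTheory
open Summit.QuantumFields.YangMills.Cruxes.DiagonalMirrorRPR.ParityBridgeColdTraces
open Summit.QuantumFields.YangMills.Cruxes.DiagonalMirrorRPR.ParityBridgeColdTraces.RpClosure (signFlip ee)

/-! # Part C — the centre-twisted cover (vocabulary and stubs VERBATIM from `Lines/centre_twisted_swap.lean`,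
same namespace `CentreTwistedSwap`, so that its registered signatures S1', S4'', N' elaborate unchanged) -/

namespace Summit.QuantumFields.YangMills.Cruxes.DiagonalMirrorRPR.CentreTwistedSwap

/-! ## §C1 The centre twist and the twisted swap reflection on the 45° torus -/

section Twist

variable {N : ℕ} {G : Type*} [Group G]

/-- The centre twist `C_z`: every `e₁`-edge variable multiplied on the left by `z`.  For central `z` it leaves every
plaquette holonomy, hence Wilson's action and every gauge-invariant function of plaquettes, unchanged; it is NOT a
gauge transformation of `T̃_N` (a loop winding the `w`-circle once meets `N` `e₁`-edges, `z^N = z` for odd `N`). -/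
def centreTwist (z : G) (U : TConfig (2 * N) N N G) : TConfig (2 * N) N N G :=
  fun e => (if e.2 = 1 then z else 1) * U e

/-- The twisted swap `Θ'_z = C_z ∘ θ^*`: `(Θ'_z U)(e) = z^{[e is an e₁-edge]} · U(swapEdge e)`. -/
def twistSwapConfig (z : G) (U : TConfig (2 * N) N N G) : TConfig (2 * N) N N G :=
  fun e => (if e.2 = 1 then z else 1) * U (swapEdge e)

/-- `Θ'_z = C_z ∘ θ^*` (definitionally). -/
theorem twistSwapConfig_eq (z : G) (U : TConfig (2 * N) N N G) :
    twistSwapConfig z U = centreTwist z (swapConfig U) := rfl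

/-- The trivial twist is the plain swap: `Θ'_1 = θ^*`. -/
@[simp] theorem twistSwapConfig_one (U : TConfig (2 * N) N N G) : twistSwapConfig (1 : G) U = swapConfig U := by
  funext e
  simp only [twistSwapConfig, swapConfig, Function.comp_apply, ite_self, one_mul]

/-- The trivial centre twist is the identity. -/
@[simp] theorem centreTwist_one (U : TConfig (2 * N) N N G) : centreTwist (1 : G) U = U := by
  funext e
  simp only [centreTwist, ite_self, one_mul]

end Twist

section TwistedRP

variable {G : Type} [Group G] [TopologicalSpace G] [IsTopologicalGroup G] [CompactSpace G]
  [MeasurableSpace G] [BorelSpace G] {Nc : ℕ}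

/-- **`Θ'_z`-reflection positivity of Wilson's measure on `T̃_N` at `(ρ, β)`**: for every bounded measurable `F`
depending only on the edges of the closed positive half, `⟨conj(F ∘ Θ'_z) · F⟩_β ≥ 0` (real and non-negative).
For `z = 1` this is `CoverSwapRPAt ρ β N` (`coverTwistedSwapRPAt_one_iff`). -/
def CoverTwistedSwapRPAt (ρ : G →* Matrix (Fin Nc) (Fin Nc) ℂ) (z : G) (β : ℝ) (N : ℕ) [NeZero N] : Prop :=
  ∀ F : TConfig (2 * N) N N G → ℂ, Measurable F → (∃ C : ℝ, ∀ U, ‖F U‖ ≤ C) →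
    DependsOn F (posEdges N) →
      0 ≤ (texp ρ β true fun U => conj (F (twistSwapConfig z U)) * F U).re ∧
        (texp ρ β true fun U => conj (F (twistSwapConfig z U)) * F U).im = 0

/-- Untwisted (`z = 1`) twisted RP is the plain swap-RP `CoverSwapRPAt` of the line `parity-bridge-cold-traces`. -/
theorem coverTwistedSwapRPAt_one_iff (ρ : G →* Matrix (Fin Nc) (Fin Nc) ℂ) (β : ℝ) (N : ℕ) [NeZero N] :
    CoverTwistedSwapRPAt ρ 1 β N ↔ CoverSwapRPAt ρ β N := by
  simp only [CoverTwistedSwapRPAt, CoverSwapRPAt, twistSwapConfig_one]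

end TwistedRP

/-! ## §C2 Statements of the centre-side stubs -/

/-- Statement of `stub_twistedSwapRP` (S1', verbatim). -/
def TwistedSwapRP : Prop :=
  ∀ (G : Type) [Group G] [TopologicalSpace G] [IsTopologicalGroup G] [CompactSpace G]
    [MeasurableSpace G] [BorelSpace G] (Nc : ℕ) (ρ : G →* Matrix (Fin Nc) (Fin Nc) ℂ),
    Continuous ρ → (∀ g, ρ g ∈ Matrix.unitaryGroup (Fin Nc) ℂ) →
      ∀ z ∈ Subgroup.center G, ρ z = -1 →
        ∀ (β : ℝ), β ≤ 0 → ∀ (N : ℕ) [NeZero N], 2 ≤ N → CoverTwistedSwapRPAt ρ z β N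

/-- Statement of `stub_rpClosureTwisted` (S4'', verbatim). -/
def RPClosureTwisted : Prop :=
  ∀ (G : Type) [Group G] [TopologicalSpace G] [IsTopologicalGroup G] [CompactSpace G]
    [MeasurableSpace G] [BorelSpace G], IsCompactSimpleLieGroup G →
    ∀ (r : LatticeRep G) (sch : SpeciesScheme (YMSpecies G)) (S₁ : SchwingerFamily E4),
      CurvaturePackage r sch S₁ →
        (∀ k, 2 ≤ sch.side k → ∃ z ∈ Subgroup.center G, CoverTwistedSwapRPAt r.ρ z (sch.β k) (sch.side k)) →
          CoverInsensitivityOffDiag r sch → DiagonalFrameRP S₁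

/-- Statement of `stub_coverTransportCentreNeg` (T_c of `centre_twisted_swap` NARROWED to the branch the composition
needs: centre data AND `β_k < 0` frequently; for `β_k ≥ 0` eventually the kms transport serves centre data too). -/
def CoverTransportCentreNeg : Prop :=
  ∀ (G : Type) [Group G] [TopologicalSpace G] [IsTopologicalGroup G] [CompactSpace G]
    [MeasurableSpace G] [BorelSpace G], IsCompactSimpleLieGroup G →
    ∀ (r : LatticeRep G) (sch : SpeciesScheme (YMSpecies G)) (S₁ : SchwingerFamily E4),
      CurvaturePackage r sch S₁ → (∃ z ∈ Subgroup.center G, r.ρ z = -1) → (∃ᶠ k in atTop, sch.β k < 0) →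
        CoverInsensitivityOffDiag r sch

/-- Statement of `stub_centreBlindNegativeScope` (N', verbatim; scope stub, no lever). -/
def CentreBlindNegativeScope : Prop :=
  ∀ (G : Type) [Group G] [TopologicalSpace G] [IsTopologicalGroup G] [CompactSpace G]
    [MeasurableSpace G] [BorelSpace G], IsCompactSimpleLieGroup G →
    ∀ (r : LatticeRep G) (sch : SpeciesScheme (YMSpecies G)) (S₁ : SchwingerFamily E4),
      CurvaturePackage r sch S₁ → (¬ ∃ z ∈ Subgroup.center G, r.ρ z = -1) → (∃ᶠ k in atTop, sch.β k < 0) →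
        DiagonalFrameRP S₁

/-! ## §C3 The centre-side registered stubs -/

/-- **S1' (M), `stub_twistedSwapRP` — twisted swap-RP of Wilson's measure on the 45° torus at non-positive
coupling** (verbatim from `Lines/centre_twisted_swap.lean`).  For every compact `G`, continuous unitary `ρ`, central
`z` with `ρ z = −𝟙`, `β ≤ 0`, `N ≥ 2` and every bounded measurable `F` of the closed positive half `0 ≤ u ≤ N`:
`⟨conj(F ∘ Θ'_z) · F⟩_β` is real and `≥ 0`, where `Θ'_z U = C_z (θ^*U)` (`twistSwapConfig`).  Intended proof: the twin
of the Literature theorem `TiltedTorusRP.integral_conj_swap_mul_nonneg` (TiltedTorusSwapRP.lean, FILS 1978 Thm 2.1 on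
the tilted torus) with `Θ := fun U e => (if e.2 = 1 then z else 1) * U (θ e)`: same blocks `M` (layer
`e₂,e₃`-links, `Θ'_z`-fixed), `P`, `cut`, `sh`, `pos`; `Θ'_z` is measure preserving (left translation by `z` on the
`e₁`-coordinates ∘ the relabelling involution) and satisfies the engine's `hΘM`, `hΘdep`; every non-cut plaquette term
is `C_z`-invariant (its `e₁`-links come in a cancelling pair, `z` central), so `A₋ = A₊ ∘ Θ'_z` and the shared
`(2,3)`-terms are untouched; on the cut, `cl k (Θ'_z U) = z · (the opposite half-plaquette of U)`, hence with
`ρ z = −𝟙` and unitarity `β · Re tr ρ(U_p) = |β| · Re ∑_{ab} ρ(cl U)_{ab} conj ρ(cl (Θ'_z U))_{ab}` — the engine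
`LatticeRP.integral_mul_conj_mul_exp_nonneg_of_shared` with `aᵢ = √(|β|/2) ·` (entries, conjugate entries); divide by
`Z ≥ 0` as in `stub_fortyFiveSwapRP`.  NOT claimed (false): plain `CoverSwapRPAt ρ β N` at `β < 0`. -/
theorem stub_twistedSwapRP :
    ∀ (G : Type) [Group G] [TopologicalSpace G] [IsTopologicalGroup G] [CompactSpace G]
      [MeasurableSpace G] [BorelSpace G] (Nc : ℕ) (ρ : G →* Matrix (Fin Nc) (Fin Nc) ℂ),
      Continuous ρ → (∀ g, ρ g ∈ Matrix.unitaryGroup (Fin Nc) ℂ) →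
        ∀ z ∈ Subgroup.center G, ρ z = -1 →
          ∀ (β : ℝ), β ≤ 0 → ∀ (N : ℕ) [NeZero N], 2 ≤ N → CoverTwistedSwapRPAt ρ z β N := by
  sorry

/-- **S4'' (M), `stub_rpClosureTwisted` — the OS-limit closure from TWISTED cover RP, no sign clause** (verbatim
from `Lines/centre_twisted_swap.lean`).  Same conclusion and the same proof as the landed S4' `stub_rpClosureOffDiag`
(…StubRpClosureOffDiag: density of slab-ordered compact real products, frame normal form, entry convergence by
`hconv` + `CoverInsensitivityOffDiag`, closedness of `{Re ≥ 0, Im = 0}`), whose sign hypothesis `_hβ` is unused and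
whose RP hypothesis is invoked exactly once, in `RpClosure.lattice_psd`, on the observables
`A k I = ∏_l coverField r sch k (f_{I,l} ∘ R⁻¹)` of the closed positive half.  The one new lemma:
`coverField r sch k f (centreTwist z U) = coverField r sch k f U` for central `z` (every plaquette holonomy is
unchanged because its `e₁`-links enter as `z·U` and `(z·U')⁻¹` with `z` central; `plaquetteObs` is a function of the
holonomy), whence `A k I (twistSwapConfig z U) = A k I (swapConfig U)` (`twistSwapConfig_eq`) and the twisted
hypothesis yields the plain Gram positivity `lattice_psd` needs. -/
theorem stub_rpClosureTwisted :
    ∀ (G : Type) [Group G] [TopologicalSpace G] [IsTopologicalGroup G] [CompactSpace G]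
      [MeasurableSpace G] [BorelSpace G], IsCompactSimpleLieGroup G →
      ∀ (r : LatticeRep G) (sch : SpeciesScheme (YMSpecies G)) (S₁ : SchwingerFamily E4),
        CurvaturePackage r sch S₁ →
          (∀ k, 2 ≤ sch.side k → ∃ z ∈ Subgroup.center G, CoverTwistedSwapRPAt r.ρ z (sch.β k) (sch.side k)) →
            CoverInsensitivityOffDiag r sch → DiagonalFrameRP S₁ := by
  sorry

/-- **T_c-neg (XL, conjecture-class; NOT a prover task) — cover transport for CENTRE data along schemes with `β_k < 0`
frequently.**  The T_c stub of `centre_twisted_swap` restricted to the branch this tree needs (for `β_k ≥ 0` eventually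
centre data are served by the kms transport `coverTransport_of`).  For `β_k < 0` it is the finite-size statement for the
model negative coupling really is: locally `β < 0 ≡ |β|` by staggered centre phases, globally the odd torus is `|β|` with
the maximal 't Hooft twist (`Negative/OddTorusTwist`) and the cover is `|β|` with a partial twist — twist-INSENSITIVITY
of local `|β|`-correlators at physical scale in a uniformly clustering phase ('t Hooft 1979; Borgs–Seiler 1983).  Not
exported by `W₁` (no clause of `W₁` compares two finite volumes at the same `k`), no lever in either skeleton (the kms
lever needs `𝕋 ≥ 0`, i.e. `β ≥ 0`); named here so that the planners see the exact residual. -/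
theorem stub_coverTransportCentreNeg :
    ∀ (G : Type) [Group G] [TopologicalSpace G] [IsTopologicalGroup G] [CompactSpace G]
      [MeasurableSpace G] [BorelSpace G], IsCompactSimpleLieGroup G →
      ∀ (r : LatticeRep G) (sch : SpeciesScheme (YMSpecies G)) (S₁ : SchwingerFamily E4),
        CurvaturePackage r sch S₁ → (∃ z ∈ Subgroup.center G, r.ρ z = -1) → (∃ᶠ k in atTop, sch.β k < 0) →
          CoverInsensitivityOffDiag r sch := by
  sorry

/-- **N' (scope stub, outside every lever; NOT a prover task; verbatim from `Lines/centre_twisted_swap.lean`).**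
Centre-blind lattice data (no central `z` with `r.ρ z = −𝟙`: `SU(2n+1)`, `G₂`, `F₄`, `E₆`, `E₈`, and centre-blind or
reducible `ρ` of the other groups) on schemes with `β_k < 0` for infinitely many `k`: no reflection-positive structure
is known for Wilson's measure at `β < 0` (the diagonal Schur cut fails, `Disproof` §5(a); the fundamental character
coefficient of `exp(β Re tr U)` on `SU(3)` is `β/2 + O(β²) < 0`; no centre element flips the sign), and `β_k → −∞` is
a genuinely different, uncontrolled frustrated model (`Disproof` §10).  Recommended crux-level repair (disprover, all
triagers, four leads): add `∀ᶠ k in atTop, 0 ≤ sch.β k` — or the weaker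
`(∃ z ∈ Subgroup.center G, r.ρ z = -1) ∨ ∀ᶠ k in atTop, 0 ≤ sch.β k` — to `W₁`, which makes this stub vacuous. -/
theorem stub_centreBlindNegativeScope :
    ∀ (G : Type) [Group G] [TopologicalSpace G] [IsTopologicalGroup G] [CompactSpace G]
      [MeasurableSpace G] [BorelSpace G], IsCompactSimpleLieGroup G →
      ∀ (r : LatticeRep G) (sch : SpeciesScheme (YMSpecies G)) (S₁ : SchwingerFamily E4),
        CurvaturePackage r sch S₁ → (¬ ∃ z ∈ Subgroup.center G, r.ρ z = -1) → (∃ᶠ k in atTop, sch.β k < 0) →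
          DiagonalFrameRP S₁ := by
  sorry

/-! ## §C4 Centre-side composition lemmas (sorry-free) -/

section Composition

variable {G : Type} [Group G] [TopologicalSpace G] [IsTopologicalGroup G] [CompactSpace G]
  [MeasurableSpace G] [BorelSpace G]

/-- **Cover RP at every coupling for centre data.**  Given S1': for `(G, r)` with a central `z`, `r.ρ z = −𝟙`, every
cover `T̃_N`, `N ≥ 2`, is `Θ'`-RP at every real `β` for some central twist — the trivial one (`Θ'_1 = θ^*`, landed S1
`stub_fortyFiveSwapRP`) when `β ≥ 0`, `Θ'_z` (S1') when `β ≤ 0`. -/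
theorem exists_coverTwistedSwapRPAt_of_centre (hS1' : TwistedSwapRP) (r : LatticeRep G) {z : G}
    (hz : z ∈ Subgroup.center G) (hρz : r.ρ z = -1) (β : ℝ) (N : ℕ) [NeZero N] (hN : 2 ≤ N) :
    ∃ z' ∈ Subgroup.center G, CoverTwistedSwapRPAt r.ρ z' β N := by
  rcases le_total β 0 with hβ | hβ
  · exact ⟨z, hz, hS1' G r.N r.ρ r.continuous r.mem_unitary z hz hρz β hβ N hN⟩
  · exact ⟨1, Subgroup.one_mem _, (coverTwistedSwapRPAt_one_iff r.ρ β N).2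
      (stub_fortyFiveSwapRP G r.N r.ρ r.continuous r.mem_unitary β hβ N hN)⟩

/-- **The centre branch.**  S1' + S4'': for centre data, the package and cover insensitivity (off-diagonal) give
`DiagonalFrameRP S₁` with NO sign clause on the couplings. -/
theorem diagonalFrameRP_of_centre (hS1' : TwistedSwapRP) (hS4'' : RPClosureTwisted)
    (hG : IsCompactSimpleLieGroup G) (r : LatticeRep G) (sch : SpeciesScheme (YMSpecies G))
    (S₁ : SchwingerFamily E4) (hW : CurvaturePackage r sch S₁) (hz : ∃ z ∈ Subgroup.center G, r.ρ z = -1)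
    (hCI : CoverInsensitivityOffDiag r sch) : DiagonalFrameRP S₁ := by
  obtain ⟨z, hzc, hρz⟩ := hz
  exact hS4'' G hG r sch S₁ hW (fun k hk => exists_coverTwistedSwapRPAt_of_centre hS1' r hzc hρz _ _ hk) hCI

end Composition

end Summit.QuantumFields.YangMills.Cruxes.DiagonalMirrorRPR.CentreTwistedSwap

/-! # Part K — the second-moment lever (line `kms-variance-lukewarm-descent`) -/

namespace Summit.QuantumFields.YangMills.Cruxes.DiagonalMirrorRPR.KmsVarianceLukewarmDescent

open CentreTwistedSwap (TwistedSwapRP RPClosureTwisted CoverTransportCentreNeg CentreBlindNegativeScope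
  stub_twistedSwapRP stub_rpClosureTwisted stub_coverTransportCentreNeg stub_centreBlindNegativeScope
  diagonalFrameRP_of_centre)

/-! ## §0 Readback -/

/-- The two route copies of the crux are the same proposition. -/
theorem shared_verbatim :
    Summit.QuantumFields.YangMills.Theses.PencilRigidity.DiagonalMirrorRPR ↔
      Summit.QuantumFields.YangMills.Theses.MirrorModularBoosts.DiagonalMirrorRPR := Iff.rfl

/-! ## §1 Vocabulary of the line (over landed declarations only)

`CurvaturePackage`, `DiagonalFrameRP`, `E4`, the box tori `TSite/TConfig/tZ/texp`, the cover `skewLift/coverSchwinger`,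
`CoverInsensitivityOffDiag` are the landed vocabulary of `Theorems/PencilRigidityDiagonalMirrorRPRStubRpClosureDefs`
/ `…OffDiag`; `signFlip`, `ee` from `…Defs` (`RpClosure`). -/

section Mirror

/-- The `e_μ`-MIRROR COPY of a real family at displacement `d`: every test function reflected in the hyperplane
`x_μ = 0` and translated by `d e_μ` (`(mirrorFamily μ d f) i (x) = f i (σ_μ (x − d e_μ))`, `σ_μ` the sign flip of
coordinate `μ`).  For `μ = 0` this is the OS adjoint partner of `HasMassGap`/E4 (real `f`: no conjugation; the order
of factors is immaterial by E3); it is also exactly the mirror-conjugate partner in the two-point trace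
`Tr(𝕋^{N−n} 𝒳† 𝕋ⁿ 𝒳)` of the variance inequality. -/
def mirrorFamily {n : ℕ} (μ : Fin 4) (d : ℝ) (f : Fin n → 𝓢(E4, ℝ)) : Fin n → 𝓢(E4, ℝ) :=
  fun i => translateTest (d • ee μ) (linActTest (signFlip {μ}) (f i))

/-- The continuum MIRROR COVARIANCE of the curvature string `f` along `e_μ` at displacement `d`:
`S₁(mirror ⊗ f) − S₁(mirror) · S₁(f)` on the canonical tensors. -/
def mirrorCov (S₁ : SchwingerFamily E4) {n : ℕ} (f : Fin n → 𝓢(E4, ℝ)) (μ : Fin 4) (d : ℝ) : ℂ :=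
  S₁ (n + n) (SchwartzMap.tensorFin (n + n) fun i => ofRealTest (Fin.append (mirrorFamily μ d f) f i)) -
    S₁ n (SchwartzMap.tensorFin n fun i => ofRealTest (mirrorFamily μ d f i)) *
      S₁ n (SchwartzMap.tensorFin n fun i => ofRealTest (f i))

/-- **Mirror clustering of the limit along `e₀` and `e₁`** (the W₁-side input of the variance lever): for every
non-empty compactly supported real family with pairwise disjoint supports, the mirror covariance tends to `0` as the
mirror copy recedes along `e₀` or `e₁`.  For families whose supports lie in pairwise disjoint `x_μ`-slabs this is
E4/`HasMassGap` of `S₁` (+ E3 to order the factors, + the proper signed permutation `(e₀,e₁) ↦ (e₁,−e₀)` of `W₁` for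
`μ = 1`); for families with overlapping `x_μ`-projections it is the extra clause (R0') of the merged card
(`thermal-variance-transfer`: "OffDiagonalMirrorClustering"), not supplied by the `e₀`-based clauses of `W₁`
(Disproof §8 blind spot) and implied by any off-coincidence kernel regularity of `S₁`. -/
def MirrorClustering (S₁ : SchwingerFamily E4) : Prop :=
  ∀ μ : Fin 4, (μ = 0 ∨ μ = 1) → ∀ (n : ℕ), n ≠ 0 → ∀ (f : Fin n → 𝓢(E4, ℝ)),
    (∀ i, HasCompactSupport (f i)) →
      (∀ i j, i ≠ j → Disjoint (tsupport (f i : E4 → ℝ)) (tsupport (f j : E4 → ℝ))) →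
        Tendsto (fun d : ℝ => mirrorCov S₁ f μ d) atTop (𝓝 0)

end Mirror

section Lukewarm

variable {G : Type} [Group G] [TopologicalSpace G] [IsTopologicalGroup G] [CompactSpace G]
  [MeasurableSpace G] [BorelSpace G] {Nc : ℕ}

/-- **Purity of the `e₁`-thermal state of the box torus `ℤ_N⁴` at coupling `β`**:
`Z(ℤ_N × ℤ_{2N} × ℤ_N²) / Z(ℤ_N⁴)²` (`= Tr 𝕋₁²ᴺ / (Tr 𝕋₁ᴺ)² = ∑ᵢ pᵢ² ∈ (0, 1]`, `pᵢ = λᵢᴺ/Z` the thermal law of the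
`e₁`-transfer matrix `𝕋₁` on the slice `ℤ_N³`; `= 1` at `β = 0`).  Stated with partition functions only. -/
def purity (ρ : G →* Matrix (Fin Nc) (Fin Nc) ℂ) (β : ℝ) (N : ℕ) [NeZero N] : ℝ :=
  tZ ρ N (2 * N) N β false / tZ ρ N N N β false ^ 2

/-- **Twist weight** `Z(T̃_N) / Z(T''_N)`: the 45° cover `ℤ⁴/⟨N(e₀ ± e₁), Ne₂, Ne₃⟩` (sheared box `(2N, N, N)`) over
the `e₁`-doubled torus `ℤ⁴/⟨Ne₀, 2Ne₁, Ne₂, Ne₃⟩` (box `(N, 2N, N)`) — both have `2N⁴` sites; slicing along `e₀`,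
`Z(T''_N) = Tr 𝔹ᴺ` and `Z(T̃_N) = Tr 𝔹ᴺ U_{Ne₁}` (`𝔹` the `e₀`-transfer matrix of the doubled slice `ℤ_{2N} × ℤ_N²`,
`U` the half-turn, `[U, 𝔹] = 0`, `U² = 1`), so the ratio is `⟨U_{Ne₁}⟩_{T''} ∈ (0, 1]` (`= 1` at `β = 0`). -/
def twistWeight (ρ : G →* Matrix (Fin Nc) (Fin Nc) ℂ) (β : ℝ) (N : ℕ) [NeZero N] : ℝ :=
  tZ ρ (2 * N) N N β true / tZ ρ N (2 * N) N β false

/-- **Purity floor along the scheme**: `purity(β_k, N_k) ≥ c > 0` for all large `k` (`N_k = sch.side k = 2L_k+1`). -/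
def PurityFloor {ι : Type} (ρ : G →* Matrix (Fin Nc) (Fin Nc) ℂ) (sch : SpeciesScheme ι) : Prop :=
  ∃ c : ℝ, 0 < c ∧ ∀ᶠ k in atTop, c ≤ purity ρ (sch.β k) (sch.side k)

/-- **Twist-weight floor along the scheme**: `Z(T̃_{N_k}) / Z(T''_{N_k}) ≥ c > 0` for all large `k`. -/
def TwistWeightFloor {ι : Type} (ρ : G →* Matrix (Fin Nc) (Fin Nc) ℂ) (sch : SpeciesScheme ι) : Prop :=
  ∃ c : ℝ, 0 < c ∧ ∀ᶠ k in atTop, c ≤ twistWeight ρ (sch.β k) (sch.side k)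

/-- **Scheme lukewarmness** = both floors (an `O(1)` condition; round-1's coldness `ζ_k → 0` is the `o(1)` condition
purity `→ 1`, twist weight `→ 1`; a finite flat band of locally indistinguishable light sectors — e.g. the `|π₁(G)|³`
't Hooft flux sectors that killed coldness — is lukewarm: purity `→ 1/q`, twist weight `→ 1`). -/
def SchemeLukewarm {ι : Type} (ρ : G →* Matrix (Fin Nc) (Fin Nc) ℂ) (sch : SpeciesScheme ι) : Prop :=
  PurityFloor ρ sch ∧ TwistWeightFloor ρ sch

end Lukewarm

section Doubled

variable {G : Type} [Group G] [TopologicalSpace G] [IsTopologicalGroup G] [CompactSpace G]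
  [MeasurableSpace G] [BorelSpace G]

/-- Reduction of `ℤ⁴` modulo `⟨Ne₀, 2Ne₁, Ne₂, Ne₃⟩` onto the sites of the unsheared box torus `(N, 2N, N)`. -/
def dblProj (N : ℕ) (x : Fin 4 → ℤ) : TSite N (2 * N) N :=
  (((x 0 : ℤ) : ZMod N), ((x 1 : ℤ) : ZMod (2 * N)), ((x 2 : ℤ) : ZMod N), ((x 3 : ℤ) : ZMod N))

/-- The `⟨Ne₀, 2Ne₁, Ne₂, Ne₃⟩`-periodic lift of a doubled-torus configuration to `ℤ⁴` (analogue of `skewLift`). -/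
def dblLift (N : ℕ) (U : TConfig N (2 * N) N G) : LGConfig 4 G := fun e => U (dblProj N e.1, e.2)

/-- The curvature-string `n`-point function at step `k` computed on the `e₁`-DOUBLED torus
`T''_{N_k} = ℤ⁴/⟨N_ke₀, 2N_ke₁, N_ke₂, N_ke₃⟩` with the scheme's spacing, coupling and renormalisations (same smearing
box `[-L_k, L_k]⁴ ⊂ ℤ⁴`, which embeds in `T''_{N_k}`). -/
def doubledSchwinger (r : LatticeRep G) (sch : SpeciesScheme (YMSpecies G)) (k n : ℕ)
    (f : Fin n → 𝓢(E4, ℝ)) : ℝ :=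
  (texp r.ρ (sch.β k) false fun U : TConfig (sch.side k) (2 * sch.side k) (sch.side k) G =>
    ((∏ i, smearedLatticeField r.curvature.F (Literature.Probability.LatticeModels.box 4 (sch.L k))
        (sch.a k) (sch.c r.curvature k) (sch.m r.curvature k) (f i) (dblLift (sch.side k) U) : ℝ) : ℂ)).re

/-- **Doubled-torus insensitivity on off-diagonal families**: for compactly supported real families with pairwise
disjoint supports, the curvature strings on the statement's torus `ℤ⁴/N_kℤ⁴` and on its `e₁`-doubled torus have
difference `→ 0` (the intermediate station of the transport). -/
def DoubledInsensitivityOffDiag (r : LatticeRep G) (sch : SpeciesScheme (YMSpecies G)) : Prop :=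
  ∀ (n : ℕ), n ≠ 0 → ∀ (f : Fin n → 𝓢(E4, ℝ)), (∀ i, HasCompactSupport (f i)) →
    (∀ i j, i ≠ j → Disjoint (tsupport (f i : E4 → ℝ)) (tsupport (f j : E4 → ℝ))) →
      Tendsto (fun k : ℕ => latticeSchwinger r.ρ sch (fun s => s.F) k n (fun _ => r.curvature) f -
        doubledSchwinger r sch k n f) atTop (𝓝 0)

end Doubled

section Reflected

variable {G : Type} [Group G] [TopologicalSpace G] [IsTopologicalGroup G] [CompactSpace G]
  [MeasurableSpace G] [BorelSpace G]

/-- The set of flipped axes of a sign pattern `ε = (flip e₀?, flip e₁?)`. -/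
def flipSet (ε : Bool × Bool) : Finset (Fin 4) :=
  (if ε.1 then {0} else ∅) ∪ (if ε.2 then {1} else ∅)

/-- The reflected test function `f ∘ σ_ε` (`σ_ε` the sign flip of the axes in `flipSet ε`; an involution). -/
def reflTest (ε : Bool × Bool) (f : 𝓢(E4, ℝ)) : 𝓢(E4, ℝ) :=
  linActTest (signFlip (flipSet ε)) f

/-- The lattice sign flip of sites, `x ↦ σ_ε x`. -/
def reflSite (ε : Bool × Bool) (x : Literature.Probability.LatticeModels.Site 4) :
    Literature.Probability.LatticeModels.Site 4 :=
  fun i => if i ∈ flipSet ε then -x i else x i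

/-- **The lattice axis reflection of gauge configurations** for the sign pattern `ε`: an edge in a flipped direction is
mapped to the REVERSED image edge, so its variable is inverted (`(θU)(x,i) = U(σx − eᵢ, i)⁻¹` for flipped `i`,
`U(σx, i)` otherwise). -/
def reflConfig (ε : Bool × Bool) (U : LGConfig 4 G) : LGConfig 4 G :=
  fun e => if e.2 ∈ flipSet ε then (U (reflSite ε e.1 - Pi.single e.2 1, e.2))⁻¹ else U (reflSite ε e.1, e.2)

/-- **Curvature strings with slotwise reflected composites**: the joint lattice `n`-point function at step `k` in which
the `i`-th smeared curvature field is evaluated on the `ε i`-reflected (periodic lift of the) configuration —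
`⟨∏ᵢ Φ_k(fᵢ)(θ_{εᵢ} Ũ)⟩_k`; for `ε ≡ (false,false)` this is `latticeSchwinger` on the curvature string.  Since the
curvature composite `actionDensity` (six FORWARD plaquettes) is covariant under axis permutations but NOT under axis
reflections, `Φ_k(f)(θU) = Φ_k^{F∘θ}(f∘σ)(U)` is a smeared field of the DIFFERENT local observable `F∘θ`: these strings
are not curvature strings. -/
def signedLatticeSchwinger (r : LatticeRep G) (sch : SpeciesScheme (YMSpecies G)) (k n : ℕ)
    (η : Fin n → Bool × Bool) (f : Fin n → 𝓢(E4, ℝ)) : ℝ :=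
  ∫ U, ∏ i, smearedLatticeField r.curvature.F (Literature.Probability.LatticeModels.box 4 (sch.L k)) (sch.a k)
      (sch.c r.curvature k) (sch.m r.curvature k) (f i) (reflConfig (η i) (torusLift (sch.side k) U))
    ∂(wilsonMeasure (d := 4) (L := sch.side k) r.ρ (sch.β k))

/-- **Reflected-composite universality (R-conv)** — the extra input the second-moment lever needs (lead a2,
`Cruxes/DiagonalMirrorRPR/NOTES.md`): for every sign pattern `η` on the axes `e₀, e₁` and every compactly supported real
family whose REFLECTED supports are pairwise disjoint, the slotwise-reflected curvature strings converge to `S₁` on the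
reflected tensor.  For `η ≡ id` this is clause 1 of `CurvaturePackage` on compact off-diagonal tensors; in general it
says that the reflected discretisations `F∘θ` of `tr F²` have the same joint continuum limit — not implied by `W₁`
(curvature-diagonal) nor by the full `IsYangMillsFor` (mixed channels are free OS data); conjecture-class, expected TRUE
for Yang–Mills (parity covariance of the scaling limit). -/
def ReflectedConvergence (r : LatticeRep G) (sch : SpeciesScheme (YMSpecies G)) (S₁ : SchwingerFamily E4) : Prop :=
  ∀ (n : ℕ), n ≠ 0 → ∀ (η : Fin n → Bool × Bool) (f : Fin n → 𝓢(E4, ℝ)), (∀ i, HasCompactSupport (f i)) →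
    (∀ i j, i ≠ j → Disjoint (tsupport (reflTest (η i) (f i) : E4 → ℝ)) (tsupport (reflTest (η j) (f j) : E4 → ℝ))) →
      Tendsto (fun k : ℕ => ((signedLatticeSchwinger r sch k n η f : ℝ) : ℂ)) atTop
        (𝓝 (S₁ n (SchwartzMap.tensorFin n fun i => ofRealTest (reflTest (η i) (f i)))))

/-- The slotwise-reflected curvature string at step `k` on the `e₁`-DOUBLED torus `T''_{N_k}` (as `doubledSchwinger`, with the
`i`-th field evaluated on the `η i`-reflected periodic lift). -/
def signedDoubledSchwinger (r : LatticeRep G) (sch : SpeciesScheme (YMSpecies G)) (k n : ℕ)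
    (η : Fin n → Bool × Bool) (f : Fin n → 𝓢(E4, ℝ)) : ℝ :=
  (texp r.ρ (sch.β k) false fun U : TConfig (sch.side k) (2 * sch.side k) (sch.side k) G =>
    ((∏ i, smearedLatticeField r.curvature.F (Literature.Probability.LatticeModels.box 4 (sch.L k))
        (sch.a k) (sch.c r.curvature k) (sch.m r.curvature k) (f i) (reflConfig (η i) (dblLift (sch.side k) U)) : ℝ) :
          ℂ)).re

/-- **Doubled-torus insensitivity for slotwise-reflected strings** (lead reshape cycle 1): for every sign pattern `η` and
every compactly supported real family with pairwise disjoint REFLECTED supports, the `η`-reflected curvature strings on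
`T_N` and on `T''_N` have difference `→ 0`.  For `η ≡ id` this is `DoubledInsensitivityOffDiag`; the twist step needs the
reflected patterns (its variance term on `T''` is a reflected string, to be moved to `T_N`), and the doubling argument
proves all patterns uniformly from `ReflectedConvergence`. -/
def SignedDoubledInsensitivityOffDiag (r : LatticeRep G) (sch : SpeciesScheme (YMSpecies G)) : Prop :=
  ∀ (n : ℕ), n ≠ 0 → ∀ (η : Fin n → Bool × Bool) (f : Fin n → 𝓢(E4, ℝ)), (∀ i, HasCompactSupport (f i)) →
    (∀ i j, i ≠ j → Disjoint (tsupport (reflTest (η i) (f i) : E4 → ℝ)) (tsupport (reflTest (η j) (f j) : E4 → ℝ))) →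
      Tendsto (fun k : ℕ => signedLatticeSchwinger r sch k n η f - signedDoubledSchwinger r sch k n η f) atTop (𝓝 0)

end Reflected

/-! ## §2 Statements of the registered stubs (the hypotheses of `DiagonalMirrorRPR_of`) -/

/-- Statement of `stub_mirrorClustering`. -/
def MirrorClusteringFromPackage : Prop :=
  ∀ (G : Type) [Group G] [TopologicalSpace G] [IsTopologicalGroup G] [CompactSpace G]
    [MeasurableSpace G] [BorelSpace G], IsCompactSimpleLieGroup G →
    ∀ (r : LatticeRep G) (sch : SpeciesScheme (YMSpecies G)) (S₁ : SchwingerFamily E4),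
      CurvaturePackage r sch S₁ → MirrorClustering S₁

/-- Statement of `stub_schemeInputs` (lead a2 reshape, cycle 1: lukewarmness AND reflected-composite universality —
the two scheme-side inputs of the lever that `W₁` does not supply). -/
def SchemeInputsFromPackage : Prop :=
  ∀ (G : Type) [Group G] [TopologicalSpace G] [IsTopologicalGroup G] [CompactSpace G]
    [MeasurableSpace G] [BorelSpace G], IsCompactSimpleLieGroup G →
    ∀ (r : LatticeRep G) (sch : SpeciesScheme (YMSpecies G)) (S₁ : SchwingerFamily E4),
      CurvaturePackage r sch S₁ → (∀ᶠ k in atTop, 0 ≤ sch.β k) → SchemeLukewarm r.ρ sch ∧ ReflectedConvergence r sch S₁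

/-- Statement of the doubling half of `stub_secondMomentLever` (with the (R-conv) input, lead reshape cycle 1). -/
def DoublingStep : Prop :=
  ∀ (G : Type) [Group G] [TopologicalSpace G] [IsTopologicalGroup G] [CompactSpace G]
    [MeasurableSpace G] [BorelSpace G]
    (r : LatticeRep G) (sch : SpeciesScheme (YMSpecies G)) (S₁ : SchwingerFamily E4),
      CurvaturePackage r sch S₁ → (∀ᶠ k in atTop, 0 ≤ sch.β k) → MirrorClustering S₁ → ReflectedConvergence r sch S₁ →
        PurityFloor r.ρ sch → SignedDoubledInsensitivityOffDiag r sch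

/-- Statement of the twist half of `stub_secondMomentLever` (with the (R-conv) input, lead reshape cycle 1). -/
def TwistStep : Prop :=
  ∀ (G : Type) [Group G] [TopologicalSpace G] [IsTopologicalGroup G] [CompactSpace G]
    [MeasurableSpace G] [BorelSpace G]
    (r : LatticeRep G) (sch : SpeciesScheme (YMSpecies G)) (S₁ : SchwingerFamily E4),
      CurvaturePackage r sch S₁ → (∀ᶠ k in atTop, 0 ≤ sch.β k) → MirrorClustering S₁ → ReflectedConvergence r sch S₁ →
        TwistWeightFloor r.ρ sch → SignedDoubledInsensitivityOffDiag r sch → CoverInsensitivityOffDiag r sch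

/-- Statement of `stub_secondMomentLever` (lead reshape: kms stubs 3 ∧ 4, `DoublingStep` and `TwistStep` verbatim,
held by one owner because the two steps share their whole transfer-operator infrastructure). -/
def SecondMomentLever : Prop := DoublingStep ∧ TwistStep

/-! ## §3 The registered stubs -/

/-- **Stub 1 — mirror clustering of the limit (W₁-side input of the variance lever).**  From the curvature package:
for `μ ∈ {0,1}` and every non-empty compactly supported real family with pairwise disjoint supports,
`mirrorCov S₁ f μ d → 0` as `d → ∞`.  Axis-orderable families (supports in pairwise disjoint `x_μ`-slabs): E4 /
`HasMassGap` of `S₁.toLabelled` for time-ordered tensors, E3 to permute the factors into increasing order, translation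
invariance, and for `μ = 1` the proper signed permutation `(e₀,e₁) ↦ (e₁,−e₀)` (determinant `1`, in `W₁`) — provable
now (M).  Families with overlapping `x_μ`-projections: NOT supplied by `W₁`'s `e₀`-based clauses (these are the
phantom's habitat, Disproof §8; with `hconv` deleted the statement is false: `vacuum + T₃` has covariance `−T₃(f)²`),
conjecture-class unless `S₁` has off-coincidence kernel regularity (cf. `PencilRigidity.CurvatureKernelBound`);
recommended to the planners as an upstream clause of `HypercubicLimit`/`W₁` next to `∀ᶠ k, 0 ≤ β_k`. -/
theorem stub_mirrorClustering :
    ∀ (G : Type) [Group G] [TopologicalSpace G] [IsTopologicalGroup G] [CompactSpace G]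
      [MeasurableSpace G] [BorelSpace G], IsCompactSimpleLieGroup G →
      ∀ (r : LatticeRep G) (sch : SpeciesScheme (YMSpecies G)) (S₁ : SchwingerFamily E4),
        CurvaturePackage r sch S₁ → MirrorClustering S₁ := by
  sorry

/-- **Stub 2 — scheme inputs (HARDEST; extra-`W₁`, conjecture-class): lukewarmness ∧ reflected-composite
universality.**  (a) Along a package-carrying scheme with eventually non-negative couplings, purity `Z(N,2N,N)/Z(N,N,N)²`
and twist weight `Z(T̃_N)/Z(T''_N)` stay bounded below.  Physics: at temperature `1/ℓ_k → 0` in a gapped phase both tend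
to `1` up to locally invisible degenerate sectors (`|π₁(G)|³` 't Hooft fluxes: purity `→ 1/q`, twist weight `→ 1`);
lattice-scale states carry entropy `(ℓ_k/a_k)³` against Boltzmann factors `e^{−ℓ_k E}`, which is where a Wilson-specific
density-of-states input is needed (TRIAGE r2-1 Part B: an abstract `W₁`-compatible FLAT band on slow schemes has
purity `→ 0`).  Not derivable from `W₁` (no clause compares two finite volumes at the same `k`), not refutable without a
controlled non-ultralocal 4D Wilson limit; exact at `β ≡ 0` (`tZ ≡ 1`, landed `stub_lukewarm_at_zero`).
(b) `ReflectedConvergence` (R-conv): the second-moment lever's variance term is `⟨X · τ(X∘θ)⟩` with `θ` an AXIS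
reflection (positivity of the centred diagonal sum IS reflection positivity), and the curvature composite
`actionDensity` (six forward plaquettes) is covariant under axis permutations only, so these are strings of the
different local observable `F∘θ`, whose convergence clause 1 of `W₁` (curvature-diagonal) does not give and whose
defect `c_k a_k⁴ Σ g(a_kx) F_temp`, `g = O(a_k)`, is uncontrolled (`c_k, m_k` arbitrary).  Expected TRUE (parity
covariance of the scaling limit), not derivable from `W₁`, not refutable without a 4D limit.  Owed by the existence leg;
the planners may promote (a), (b) or the whole transport to items / clauses of `W₁`. -/
theorem stub_schemeInputs :
    ∀ (G : Type) [Group G] [TopologicalSpace G] [IsTopologicalGroup G] [CompactSpace G]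
      [MeasurableSpace G] [BorelSpace G], IsCompactSimpleLieGroup G →
      ∀ (r : LatticeRep G) (sch : SpeciesScheme (YMSpecies G)) (S₁ : SchwingerFamily E4),
        CurvaturePackage r sch S₁ → (∀ᶠ k in atTop, 0 ≤ sch.β k) →
          SchemeLukewarm r.ρ sch ∧ ReflectedConvergence r sch S₁ := by
  sorry

/-- **The lever (lead-held; kms stubs 3 ∧ 4 merged), `stub_secondMomentLever : DoublingStep ∧ TwistStep`.**

*Doubling step* (`DoublingStep`, expected TRUE, L).  `T_N = ℤ⁴/Nℤ⁴` and `T''_N = ℤ⁴/⟨Ne₀,2Ne₁,Ne₂,Ne₃⟩` have the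
same `e₁`-slices `ℤ_N³`, hence the same positive self-adjoint Hilbert–Schmidt `e₁`-transfer operator `𝕋₁` of Wilson's
action (`β_k ≥ 0`; Lüscher 1977, Osterwalder–Seiler 1978 §2): temporal links integrated into the kernel
`K(U,U') = w(U) k(U,U') w(U')`, `k ≥ 0` as an operator by the Gram expansion of the crossing Boltzmann weight
(tree engine `LatticeRP.integral_mul_conj_mul_exp_nonneg_of_shared`), trace formula `Z_M = ∑ᵢ λᵢᴹ`
(`KernelCyclicPeeling` + Parseval in the eigenbasis of `CompactSelfAdjointEigenbasis`), slab insertions `𝒳` with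
`Z_M⟨X⟩_M = ∑ᵢ λᵢ^{M−s} xᵢᵢ` and `Z_M⟨X · θ_D X⟩_M = ∑ᵢⱼ λᵢ^{a} λⱼ^{b} xᵢⱼ²`.  Then (Cauchy–Schwarz)
`|⟨X⟩_{T''} − ⟨X⟩_T|² ≤ (∑ qᵢ²/pᵢ − 1) Var_p(x) ≤ Var_p(x)/purity` and (termwise positivity, `λ ≥ 0`)
`Var_p(x) ≤ ⟨X · θ_D X⟩_T − ⟨X⟩_T²` at EVERY lattice mirror distance `D` (landed: `TransferSpectralDoubling`,
`TransferKernelDoubling`); `ReflectedConvergence` on the reflected juxtaposition (the variance term is a string of the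
REFLECTED composite — lead a2, crux NOTES.md) + `hconv` + `MirrorClustering` (`μ = 1`) + `PurityFloor` give the
doubling error `→ 0`.  Bookkeeping: `latticeSchwinger` (`wilsonMeasure`, `torusLift`) = the box-torus `(N,N,N)` expectation;
products of smeared curvature fields of compact families are slab observables of width `O(diam supp f / a_k) ≪ N_k`;
the sub-lattice rounding of the mirror position needs local uniformity of the lattice functionals on the closed
subspaces `𝓢_C` (Banach–Steinhaus for multilinear maps on Fréchet spaces, from pointwise `hconv`).

*Twist step* (`TwistStep`, expected TRUE, L).  Slice `T''_N` and the cover `T̃_N = ℤ⁴/⟨N(e₀±e₁),Ne₂,Ne₃⟩` along `e₀`: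
both have the doubled slice `ℤ_{2N} × ℤ_N²` and its positive `e₀`-transfer operator `𝔹` (`β_k ≥ 0`),
`Z(T''_N) = Tr 𝔹ᴺ`, `Z(T̃_N) = Tr 𝔹ᴺU` with `U` = translation by `Ne₁` (`x + Ne₀ ≡ x − Ne₁` mod `Λ̃_N`; the sheared
chart `(u,w) = (x₀−x₁, x₁)` of `tZ … true` / `skewLift`), `[U,𝔹] = 0`, `U² = 1`; in a joint eigenbasis `uᵢ = ±1` and
`|⟨X⟩_{T̃} − ⟨X⟩_{T''}| ≤ √Var_q(x) / twistWeight`; `Var_q ≤` the `e₀`-mirror covariance of `X` on `T''`, moved to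
`T_N` by `DoubledInsensitivityOffDiag`, to `mirrorCov S₁ f 0 d` by `hconv`, to `0` by `MirrorClustering` (`μ = 0`);
with `TwistWeightFloor` the twist error `→ 0`, hence `latticeSchwinger − coverSchwinger → 0`.

One owner (the lead) because the two steps share the slicing calculus; its pieces land as `--supports` files
(slicing of the box tori, `𝕋 ≥ 0`, trace formulas, measure-level doubling / twist inequalities) as they close. -/
theorem stub_secondMomentLever : SecondMomentLever := by
  sorry

/-! ## §4 Composition (kernel-checked, no `sorry`) -/

/-- **Transport from the lever.**  Mirror clustering + the scheme inputs (lukewarmness, R-conv) + the two steps give the transport statement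
consumed by the landed reduction: `CurvaturePackage → (∀ᶠ k, 0 ≤ β_k) → CoverInsensitivityOffDiag` (this is VERBATIM
the shared stub `stub_coverTransportOffDiag` (T) of `parity_bridge_cold_traces.lean` / `centre_twisted_swap.lean`). -/
theorem coverTransport_of (h1 : MirrorClusteringFromPackage) (h2 : SchemeInputsFromPackage)
    (hL : SecondMomentLever) :
    ∀ (G : Type) [Group G] [TopologicalSpace G] [IsTopologicalGroup G] [CompactSpace G]
      [MeasurableSpace G] [BorelSpace G], IsCompactSimpleLieGroup G →
      ∀ (r : LatticeRep G) (sch : SpeciesScheme (YMSpecies G)) (S₁ : SchwingerFamily E4),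
        CurvaturePackage r sch S₁ → (∀ᶠ k in atTop, 0 ≤ sch.β k) → CoverInsensitivityOffDiag r sch := by
  intro G _ _ _ _ _ _ hG r sch S₁ hW hβ
  have hMC : MirrorClustering S₁ := h1 G hG r sch S₁ hW
  obtain ⟨hLW, hRC⟩ := h2 G hG r sch S₁ hW hβ
  exact hL.2 G r sch S₁ hW hβ hMC hRC hLW.2 (hL.1 G r sch S₁ hW hβ hMC hRC hLW.1)

/-- **The tree concludes the crux** (the `PencilRigidity` copy, by name) from its seven registered stubs:
`β_k ≥ 0` eventually → kms transport + the landed `Reduction.diagonalFrameRP_of_coverInsensitivityOffDiag`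
(tail shift + S1 + S4'); `β_k < 0` frequently, centre data → T_c-neg + S1/S1' + S4''; `β_k < 0` frequently,
centre-blind data → N'. -/
theorem DiagonalMirrorRPR_of :
    MirrorClusteringFromPackage → SchemeInputsFromPackage → SecondMomentLever →
      TwistedSwapRP → RPClosureTwisted → CoverTransportCentreNeg → CentreBlindNegativeScope →
        Summit.QuantumFields.YangMills.Theses.PencilRigidity.DiagonalMirrorRPR := by
  intro h1 h2 hL hS1' hS4'' hTc hN'
  -- readback: the decl is definitionally `∀ G simple, r, sch, S₁: CurvaturePackage → DiagonalFrameRP`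
  have hiff : Summit.QuantumFields.YangMills.Theses.PencilRigidity.DiagonalMirrorRPR ↔
      ∀ (G : Type) [Group G] [TopologicalSpace G] [IsTopologicalGroup G] [CompactSpace G],
        IsCompactSimpleLieGroup G →
          letI : MeasurableSpace G := borel G
          haveI : BorelSpace G := ⟨rfl⟩
          ∀ (r : LatticeRep G) (sch : SpeciesScheme (YMSpecies G)) (S₁ : SchwingerFamily E4),
            CurvaturePackage r sch S₁ → DiagonalFrameRP S₁ := Iff.rfl
  refine hiff.mpr ?_
  intro G _ _ _ _ hG
  letI : MeasurableSpace G := borel G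
  haveI : BorelSpace G := ⟨rfl⟩
  intro r sch S₁ hW
  by_cases hev : ∀ᶠ k in atTop, 0 ≤ sch.β k
  · exact Reduction.diagonalFrameRP_of_coverInsensitivityOffDiag hG r sch S₁ hW hev
      (coverTransport_of h1 h2 hL G hG r sch S₁ hW hev)
  · have hneg : ∃ᶠ k in atTop, sch.β k < 0 := by
      simpa only [Filter.not_eventually, not_le] using hev
    by_cases hz : ∃ z ∈ Subgroup.center G, r.ρ z = -1
    · exact diagonalFrameRP_of_centre hS1' hS4'' hG r sch S₁ hW hz (hTc G hG r sch S₁ hW hz hneg)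
    · exact hN' G hG r sch S₁ hW hz hneg

/-- **Skeleton theorem** (hypothesis-free: the composition applied to the registered stubs; it becomes the crux
proof when the last stub is discharged).  Concludes the `MirrorModularBoosts` copy (shared verbatim). -/
theorem DiagonalMirrorRPR_proof :
    Summit.QuantumFields.YangMills.Theses.MirrorModularBoosts.DiagonalMirrorRPR :=
  shared_verbatim.mp
    (DiagonalMirrorRPR_of stub_mirrorClustering stub_schemeInputs stub_secondMomentLever stub_twistedSwapRP
      stub_rpClosureTwisted stub_coverTransportCentreNeg stub_centreBlindNegativeScope)


end Summit.QuantumFields.YangMills.Cruxes.DiagonalMirrorRPR.KmsVarianceLukewarmDescent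

end
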